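import Literature.NumberTheory.Automorphic.SatakeW0SymmetryAdicCompletion
import Literature.NumberTheory.Automorphic.SplitOrthogonalBorelModulusIndex
import HarnessLib

/-!
# The unramified Hecke eigencharacters are invariant under `w₀` of the parameter: `λ_{χ∘w₀} = λ_χ`
# (`λ_{χ⁻¹} = λ_χ` for `Sp_{2n}`, `U_N`, `O_N`; `λ_{χ∘w₀} = λ_χ` for `GSp_{2n}`), locally and at the places of a number field
# (Cartier §IV (4.2)–(4.4), Thm. 4.1; Andrianov–Zhuravlev Ch. 3 Prop. 3.36; Mínguez §4)

Topic `NumberTheory/Automorphic`; namespaces `Literature.NumberTheory.Automorphic[.IsIwasawaExponent]` (§1),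
`….SymplecticCartan` (§2), `….HermitianLattice.UnramifiedLocalConjDatum` (§3), `….UnitaryGroup` (§4) (lane `lit-hodgefound`,
Track 2 foundations; seat `lit-hodgefound-p11`, generation 47, row g47-#7).  THEOREMS ONLY: no definition, no named fact, no
instance, no notation.  Consequence of the `w₀`-symmetries of the Satake transforms (`SymplecticBorelModulusIndex` g45-#4,
`SymplecticSimilitudeBorelModulusIndex` g45-#6, `HyperspecialUnitarySatakeClassicalSymmetry` g47-#3,
`HyperspecialUnitarySatakeIntegralSymmetry` g47-#4, `SplitOrthogonalBorelModulusIndex` g47-#5, `SatakeW0SymmetryAdicCompletion`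
g47-#6) for the EIGENCHARACTERS `λ_χ = ev_χ ∘ 𝒮` (`IsIwasawaExponent.heckeEigencharacter`, `symplecticHeckeEigencharacter`,
`similitudeHeckeEigencharacter`, `UnramifiedLocalConjDatum.heckeEigencharacter`, and their place-indexed versions).

## The mathematics

`λ_χ(T) = ev_χ(𝒮 T) = Σ_μ 𝒮(T)_μ χ(μ)` (Cartier (4.4): the eigenvalue of `T` on the spherical vector of the unramified principal
series `I(χ)`).  For an additive automorphism `e` of the cocharacter lattice, `ev_χ(e_* f) = ev_{χ∘e}(f)` (`lift_domCongr`), so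
whenever the Satake image is `e`-invariant (`e_*(𝒮 T) = 𝒮 T`) the eigencharacters of `χ` and `χ ∘ e` COINCIDE: `λ_{χ∘e} = λ_χ`
— the unramified principal series `I(χ)` and `I(χ^{w})` have the same spherical eigenvalues (Cartier Thm. 4.1 read on
characters; for `e = -1`: `λ_{χ⁻¹} = λ_χ`, `I(χ)` and its contragredient).  With the tree's `w₀`-symmetries this gives, for every
rank: `λ_{χ⁻¹} = λ_χ` for `Sp_{2n}` (`q ∈ Rˣ` the residue cardinality), `λ_{χ∘w₀} = λ_χ` for `GSp_{2n}` (`w₀(α, c) = (c·1-α, c)`),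
`λ_{β⁻¹} = λ_β` for the unitarily normalised `ℂ`-eigencharacters of `U_N` (`σ ≠ id`, `β ∈ (ℂˣ)^N`), `λ_{χ⁻¹} = λ_χ` for the
integral `U_N`- and the orthogonal `O_N`-normalisations, and the same at every finite place `v` of a number field
(`symplecticHeckeEigencharacterAdic`, `similitudeHeckeEigencharacterAdic`) and every inert unramified place `w` of a quadratic
extension (`unitaryHeckeEigencharacterAdic`).

## What is formalised (theorems only)

* §1 `lift_domCongr` (`ev_χ(e_* f) = ev_{χ∘e} f`), `lift_comp_inv_eq_of_domCongr_neg_eq`, `laurentMonomialHom_inv`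
  (`z⁻¹ ↦ (z-monomial) ∘ inv`), **`IsIwasawaExponent.heckeEigencharacter_comp_inv_eq`** (abstract: `ι(𝒮_w T) = 𝒮_w T` for all
  `T` ⇒ `λ_{χ⁻¹} = λ_χ`), `IsIwasawaExponent.heckeEigencharacter_eq_of_forall_coeff` (abstract, any `e`).
* §2 **`symplecticHeckeEigencharacter_comp_inv`** (`Sp_{2n}`, every `n`), **`similitudeHeckeEigencharacter_w0`** (`GSp_{2n}`,
  `n ≥ 1`), `symplecticHeckeEigencharacterAdic_comp_inv`, `similitudeHeckeEigencharacterAdic_w0` (every finite place).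
* §3 **`heckeEigencharacter_inv_unitary`** (`λ_{β⁻¹} = λ_β`, `U_N`, `σ ≠ id`, every `N`),
  `heckeEigencharacter_comp_inv_of_units_unitary` (integral weight), `heckeEigencharacter_comp_inv_of_units_orthogonal` (`σ = id`).
* §4 **`unitaryHeckeEigencharacterAdic_inv`** (every inert unramified place).

## References
* [CartierCorvallis1979] P. Cartier, *Representations of 𝔭-adic groups: a survey*, PSPM 33.1 (1979), §IV (4.2)–(4.4), Thm. 4.1.
* [AndrianovZhuravlev1995] A. N. Andrianov, V. G. Zhuravlev, *Modular Forms and Hecke Operators* (1995), Ch. 3 §3.3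
  Thm. 3.30, Prop. 3.36.
* [Minguez2011] A. Mínguez, *Unramified representations of unitary groups* (2011), §4.
* [Satake1963] I. Satake, Publ. Math. IHÉS 18 (1963), §§6–9.
-/

noncomputable section

open scoped Valued WithZero Matrix MatrixGroups
open Matrix MonoidAlgebra Representation NumberField IsDedekindDomain

namespace Literature.NumberTheory.Automorphic

/-! ## §1 `ev_χ ∘ e_* = ev_{χ∘e}` and the abstract invariance -/

section Lift

variable {R : Type*} [CommRing R] {Λ Λ' : Type*} [AddCommGroup Λ] [AddCommGroup Λ']

/-- **`ev_χ(e_* f) = ev_{χ∘e}(f)`**: evaluating the push-forward of `f ∈ R[Λ]` along an additive isomorphism `e : Λ ≃ Λ'` at a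
character `χ` of `Λ'` is evaluating `f` at `χ ∘ e`. [cite: CartierCorvallis1979, §IV (4.2)–(4.4)] -/
theorem lift_domCongr (e : Λ ≃+ Λ') (χ : Multiplicative Λ' →* R) (f : AddMonoidAlgebra R Λ) :
    AddMonoidAlgebra.lift R R Λ' χ (AddMonoidAlgebra.domCongr R R e f) =
      AddMonoidAlgebra.lift R R Λ (χ.comp (AddMonoidHom.toMultiplicative e.toAddMonoidHom)) f := by
  induction f using AddMonoidAlgebra.induction_linear with
  | zero => rw [map_zero, map_zero, map_zero]
  | add f g hf hg => rw [map_add, map_add, map_add, hf, hg]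
  | single m c =>
    rw [AddMonoidAlgebra.domCongr_single, AddMonoidAlgebra.lift_single, AddMonoidAlgebra.lift_single]
    rfl

/-- **`ev_{χ⁻¹}(f) = ev_χ(f)` for `ι`-invariant `f`** (`ι(x^μ) = x^{-μ}`, `χ⁻¹ = χ ∘ inv`). [cite: CartierCorvallis1979, §IV (4.2)–(4.4)] -/
theorem lift_comp_inv_eq_of_domCongr_neg_eq (χ : Multiplicative Λ →* R) {f : AddMonoidAlgebra R Λ}
    (hf : AddMonoidAlgebra.domCongr R R (AddEquiv.neg Λ) f = f) :
    AddMonoidAlgebra.lift R R Λ (χ.comp invMonoidHom) f = AddMonoidAlgebra.lift R R Λ χ f := by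
  have h := lift_domCongr (AddEquiv.neg Λ) χ f
  rw [hf] at h
  rw [h]
  exact congrArg (fun ψ : Multiplicative Λ →* R => AddMonoidAlgebra.lift R R Λ ψ f) (MonoidHom.ext fun _ => rfl)

/-- **`ev_{χ∘e}(f) = ev_χ(f)` for `e`-invariant `f`**. [cite: CartierCorvallis1979, §IV (4.2)–(4.4)] -/
theorem lift_comp_eq_of_domCongr_eq (e : Λ ≃+ Λ) (χ : Multiplicative Λ →* R) {f : AddMonoidAlgebra R Λ}
    (hf : AddMonoidAlgebra.domCongr R R e f = f) :
    AddMonoidAlgebra.lift R R Λ (χ.comp (AddMonoidHom.toMultiplicative e.toAddMonoidHom)) f = AddMonoidAlgebra.lift R R Λ χ f := by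
  have h := lift_domCongr e χ f
  rw [hf] at h
  exact h.symm

end Lift

/-- **`(z⁻¹)`-monomials are `z`-monomials composed with inversion**: `∏ (z_i⁻¹)^{m_i} = ∏ z_i^{-m_i}`.
[cite: CartierCorvallis1979, §IV (4.2)] -/
theorem laurentMonomialHom_inv {n : ℕ} (z : Fin n → ℂˣ) :
    laurentMonomialHom z⁻¹ = (laurentMonomialHom z).comp invMonoidHom := by
  refine MonoidHom.ext fun m => ?_
  rw [MonoidHom.comp_apply, invMonoidHom_apply]
  change (((∏ i, (z⁻¹) i ^ (Multiplicative.toAdd m i) : ℂˣ) : ℂ)) =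
    ((∏ i, z i ^ (Multiplicative.toAdd m⁻¹ i) : ℂˣ) : ℂ)
  congr 1
  exact Finset.prod_congr rfl fun i _ => by rw [Pi.inv_apply, _root_.inv_zpow', toAdd_inv, Pi.neg_apply]

namespace IsIwasawaExponent

variable {G : Type*} [Group G] {Λ : Type*} [AddCommGroup Λ] {R : Type*} [CommRing R] {P K : Subgroup G} {a : G → Λ}

/-- **ABSTRACT `λ_{χ⁻¹} = λ_χ`**: if every Satake transform `𝒮_w T` is fixed by the antipode `ι`, the eigencharacters of `χ` and
`χ⁻¹ = χ ∘ inv` coincide (the spherical eigenvalues of `I(χ)` and of its contragredient `I(χ⁻¹)` agree).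
[cite: CartierCorvallis1979, §IV (4.2)–(4.4), Thm. 4.1] -/
theorem heckeEigencharacter_comp_inv_eq (h : IsIwasawaExponent P K a) (w χ : Multiplicative Λ →* R)
    (hsymm : ∀ T : heckeAlgebra R G K,
      AddMonoidAlgebra.domCongr R R (AddEquiv.neg Λ) (h.satakeTransform w T) = h.satakeTransform w T) :
    h.heckeEigencharacter w (χ.comp invMonoidHom) = h.heckeEigencharacter w χ := by
  refine AlgHom.ext fun T => ?_
  rw [h.heckeEigencharacter_apply, h.heckeEigencharacter_apply, lift_comp_inv_eq_of_domCongr_neg_eq χ (hsymm T)]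

/-- **ABSTRACT `λ_{χ∘e} = λ_χ`** for any additive automorphism `e` of `Λ` fixing every Satake transform coefficientwise
(`(𝒮_w T)_{e μ} = (𝒮_w T)_μ`). [cite: CartierCorvallis1979, §IV (4.2)–(4.4), Thm. 4.1] -/
theorem heckeEigencharacter_eq_of_forall_coeff (h : IsIwasawaExponent P K a) (w χ : Multiplicative Λ →* R) (e : Λ ≃+ Λ)
    (hsymm : ∀ (T : heckeAlgebra R G K) (μ : Λ), (h.satakeTransform w T).coeff (e μ) = (h.satakeTransform w T).coeff μ) :
    h.heckeEigencharacter w (χ.comp (AddMonoidHom.toMultiplicative e.toAddMonoidHom)) = h.heckeEigencharacter w χ := by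
  refine AlgHom.ext fun T => ?_
  rw [h.heckeEigencharacter_apply, h.heckeEigencharacter_apply,
    lift_comp_eq_of_domCongr_eq e χ ((domCongr_eq_self_iff_coeff e _).2 (hsymm T))]

end IsIwasawaExponent

end Literature.NumberTheory.Automorphic

/-! ## §2 `Sp_{2n}` and `GSp_{2n}`: locally and at every finite place -/

namespace Literature.NumberTheory.Automorphic.SymplecticCartan

open Literature.NumberTheory.Automorphic.CartanUnique Literature.NumberTheory.Automorphic

section Local

variable {K : Type*} [Field K] [Valued K ℤᵐ⁰] {ϖ : K} {n : ℕ} {R : Type*} [CommRing R]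
  (hϖ : Valued.v ϖ = WithZero.exp (-1 : ℤ)) [Finite 𝓀[K]]

/-- **`λ_{χ⁻¹} = λ_χ` FOR `Sp_{2n}(K)`, EVERY `n`** (`q ∈ Rˣ` the residue cardinality, any commutative `R`): the unramified
eigencharacters of `ℋ(Sp_{2n}(K), Sp_{2n}(𝒪); R)` do not separate `χ` from `χ⁻¹` (`w₀ = -1 ∈ W(C_n)`).
[cite: CartierCorvallis1979, §IV (4.2)–(4.4), Thm. 4.1] [cite: AndrianovZhuravlev1995, Ch. 3 §3.3 Prop. 3.36] -/
theorem symplecticHeckeEigencharacter_comp_inv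
    [IsHeckeTriple (⊤ : Submonoid (symplecticGroup (Fin n) K)) (symplecticInt (Fin n) K) (symplecticInt (Fin n) K)]
    (q : Rˣ) (hq : (q : R) = Nat.card 𝓀[K]) (χ : Multiplicative (Fin n → ℤ) →* R) :
    symplecticHeckeEigencharacter hϖ q (χ.comp invMonoidHom) = symplecticHeckeEigencharacter hϖ q χ :=
  (isIwasawaExponent_symplectic hϖ).heckeEigencharacter_comp_inv_eq _ χ fun T =>
    domCongr_neg_symplecticSatakeTransform hϖ q hq T

/-- **`λ_{χ∘w₀} = λ_χ` FOR `GSp_{2n}(K)`, `n ≥ 1`** (`w₀(α, c) = (c·1 - α, c)`; `q ∈ Rˣ` the residue cardinality): for any two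
torus parameters `χ, χ'` with `χ'(α, c) = χ(c·1 - α, c)` the eigencharacters coincide.
[cite: AndrianovZhuravlev1995, Ch. 3 §3.3 Thm. 3.30, Prop. 3.36] [cite: CartierCorvallis1979, §IV Thm. 4.1] -/
theorem similitudeHeckeEigencharacter_w0 [NeZero n]
    [IsHeckeTriple (⊤ : Submonoid (symplecticSimilitudeGroup (Fin n) K)) (symplecticSimilitudeInt (Fin n) K)
      (symplecticSimilitudeInt (Fin n) K)]
    (q : Rˣ) (hq : (q : R) = Nat.card 𝓀[K]) (χ χ' : Multiplicative ((Fin n → ℤ) × ℤ) →* R)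
    (hχ : ∀ (α : Fin n → ℤ) (c : ℤ), χ' (Multiplicative.ofAdd (α, c)) = χ (Multiplicative.ofAdd (fun i => c - α i, c))) :
    similitudeHeckeEigencharacter hϖ q χ' = similitudeHeckeEigencharacter hϖ q χ := by
  -- `w₀` as an additive involution of `ℤⁿ × ℤ`
  let e : ((Fin n → ℤ) × ℤ) ≃+ ((Fin n → ℤ) × ℤ) :=
    { toFun := fun p => (fun i => p.2 - p.1 i, p.2)
      invFun := fun p => (fun i => p.2 - p.1 i, p.2)
      left_inv := fun p => by ext <;> simp
      right_inv := fun p => by ext <;> simp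
      map_add' := fun p p' => by
        ext i
        · simp only [Prod.fst_add, Prod.snd_add, Pi.add_apply]; ring
        · rfl }
  have hχ' : χ' = χ.comp (AddMonoidHom.toMultiplicative e.toAddMonoidHom) := by
    refine MonoidHom.ext fun m => ?_
    obtain ⟨⟨α, c⟩, rfl⟩ : ∃ p, Multiplicative.ofAdd p = m := ⟨Multiplicative.toAdd m, rfl⟩
    rw [hχ]
    rfl
  rw [hχ']
  exact (isIwasawaExponent_similitude hϖ).heckeEigencharacter_eq_of_forall_coeff _ χ e fun T μ =>
    coeff_similitudeSatakeTransform_w0 hϖ q hq T μ.1 μ.2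

end Local

section NumberField

variable (F : Type*) [Field F] [NumberField F] (v : HeightOneSpectrum (𝓞 F)) {n : ℕ}

/-- **`λ_{χ⁻¹} = λ_χ` for `Sp_{2n}(F_v)` at every finite place `v`**, every `n`.
[cite: CartierCorvallis1979, §IV (4.2)–(4.4), Thm. 4.1] [cite: AndrianovZhuravlev1995, Ch. 3 §3.3 Prop. 3.36] -/
theorem symplecticHeckeEigencharacterAdic_comp_inv (χ : Multiplicative (Fin n → ℤ) →* ℂ) :
    symplecticHeckeEigencharacterAdic F v (χ.comp invMonoidHom) = symplecticHeckeEigencharacterAdic F v χ := by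
  haveI := finite_residueField_adicCompletion F v
  haveI := isHeckeTriple_symplecticInt_adicCompletion F v (l := Fin n)
  exact symplecticHeckeEigencharacter_comp_inv (v_adicUniformizer F v) (residueNormUnit F v)
    (coe_residueNormUnit_eq_natCard F v) χ

/-- **`λ_{χ∘w₀} = λ_χ` for `GSp_{2n}(F_v)` at every finite place `v`**, `n ≥ 1`.
[cite: AndrianovZhuravlev1995, Ch. 3 §3.3 Thm. 3.30, Prop. 3.36] [cite: CartierCorvallis1979, §IV Thm. 4.1] -/
theorem similitudeHeckeEigencharacterAdic_w0 [NeZero n] (χ χ' : Multiplicative ((Fin n → ℤ) × ℤ) →* ℂ)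
    (hχ : ∀ (α : Fin n → ℤ) (c : ℤ), χ' (Multiplicative.ofAdd (α, c)) = χ (Multiplicative.ofAdd (fun i => c - α i, c))) :
    similitudeHeckeEigencharacterAdic F v χ' = similitudeHeckeEigencharacterAdic F v χ := by
  haveI := finite_residueField_adicCompletion F v
  haveI := isHeckeTriple_symplecticSimilitudeInt_adicCompletion F v (l := Fin n)
  exact similitudeHeckeEigencharacter_w0 (v_adicUniformizer F v) (residueNormUnit F v)
    (coe_residueNormUnit_eq_natCard F v) χ χ' hχ

end NumberField

end Literature.NumberTheory.Automorphic.SymplecticCartan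

/-! ## §3 `U_N` (`σ ≠ id`) and `O_N` (`σ = id`), locally -/

namespace Literature.NumberTheory.Automorphic.HermitianLattice

open Literature.NumberTheory.Automorphic.CartanUnique Literature.NumberTheory.Automorphic.SymplecticCartan
  Literature.NumberTheory.Automorphic

variable {K : Type*} [Field K] [Valued K ℤᵐ⁰] {σ : K →+* K} {ϖ : K} {N : ℕ} [Finite 𝓀[K]]

namespace UnramifiedLocalConjDatum

/-- **`λ_{β⁻¹} = λ_β` FOR `U_N`, EVERY `N`** (`σ ≠ id`; the unitarily normalised `ℂ`-eigencharacters `λ_β = 𝒮(·)(β)`,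
`β ∈ (ℂˣ)^N`): the torus parameter of an unramified eigencharacter is determined at most up to `β ↦ β⁻¹`.
[cite: CartierCorvallis1979, §IV (4.2)–(4.4), Thm. 4.1] [cite: Minguez2011, §4] -/
theorem heckeEigencharacter_inv_unitary
    [IsHeckeTriple (⊤ : Submonoid (unitaryGroupOfForm σ ((StdForm.antidiagonal N).over K)))
      (unitaryInt σ ((StdForm.antidiagonal N).over K)) (unitaryInt σ ((StdForm.antidiagonal N).over K))]
    (hd : UnramifiedLocalConjDatum σ ϖ) (hσ : ∃ x : K, σ x ≠ x) (β : Fin N → ℂˣ) :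
    hd.heckeEigencharacter β⁻¹ = hd.heckeEigencharacter β := by
  refine AlgHom.ext fun T => ?_
  rw [hd.heckeEigencharacter_apply, hd.heckeEigencharacter_apply, laurentEvalAt, laurentEvalAt, laurentMonomialHom_inv,
    lift_comp_inv_eq_of_domCongr_neg_eq _ (hd.domCongr_neg_satakeTransform_unitary hσ T)]

/-- **`λ_{χ⁻¹} = λ_χ` for the INTEGRALLY normalised eigencharacters of `U_N`** (weight `u^{-⟨ν,·⟩}`, `u ∈ Rˣ`, `(u : R) = q_F`; any
commutative `R`, every `N`). [cite: CartierCorvallis1979, §IV (4.2)–(4.4), Thm. 4.1] [cite: Minguez2011, §4] -/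
theorem heckeEigencharacter_comp_inv_of_units_unitary {R : Type*} [CommRing R]
    [IsHeckeTriple (⊤ : Submonoid (unitaryGroupOfForm σ ((StdForm.antidiagonal N).over K)))
      (unitaryInt σ ((StdForm.antidiagonal N).over K)) (unitaryInt σ ((StdForm.antidiagonal N).over K))]
    (hd : UnramifiedLocalConjDatum σ ϖ) (hσ : ∃ x : K, σ x ≠ x) (u : Rˣ) (hu : (u : R) = Nat.sqrt (Nat.card 𝓀[K]))
    (w : Multiplicative (Fin N → ℤ) →* R)
    (hw : ∀ e : Fin N → ℤ, w (Multiplicative.ofAdd e) = ((u ^ (-satakeTwistExp e) : Rˣ) : R))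
    (χ : Multiplicative (Fin N → ℤ) →* R) :
    (hd.isIwasawaExponent (N := N)).heckeEigencharacter w (χ.comp invMonoidHom) =
      (hd.isIwasawaExponent (N := N)).heckeEigencharacter w χ :=
  (hd.isIwasawaExponent (N := N)).heckeEigencharacter_comp_inv_eq w χ fun T =>
    hd.domCongr_neg_satakeTransform_of_units_unitary hσ u hu w hw T

/-- **`λ_{χ⁻¹} = λ_χ` for the split orthogonal group `O_N(J₀)`** (`σ = id`; orthogonal weight `u^{-Λ(·)}`, `u ∈ Rˣ`, `u² = q`;
any commutative `R`, every `N`). [cite: CartierCorvallis1979, §IV (4.2)–(4.4), Thm. 4.1] [cite: Satake1963, §§8–9] -/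
theorem heckeEigencharacter_comp_inv_of_units_orthogonal {R : Type*} [CommRing R]
    [IsHeckeTriple (⊤ : Submonoid (unitaryGroupOfForm (RingHom.id K) ((StdForm.antidiagonal N).over K)))
      (unitaryInt (RingHom.id K) ((StdForm.antidiagonal N).over K)) (unitaryInt (RingHom.id K) ((StdForm.antidiagonal N).over K))]
    (hd : UnramifiedLocalConjDatum (RingHom.id K) ϖ) (u : Rˣ) (hu : (u : R) ^ 2 = Nat.card 𝓀[K])
    (w : Multiplicative (Fin N → ℤ) →* R)
    (hw : ∀ e : Fin N → ℤ, w (Multiplicative.ofAdd e) =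
      ((u ^ (-∑ p ∈ (Finset.univ : Finset (Fin N × Fin N)) with (p.1 < p.2 ∧ p.1 < Fin.rev p.2), (e p.1 - e p.2)) : Rˣ) : R))
    (χ : Multiplicative (Fin N → ℤ) →* R) :
    (hd.isIwasawaExponent (N := N)).heckeEigencharacter w (χ.comp invMonoidHom) =
      (hd.isIwasawaExponent (N := N)).heckeEigencharacter w χ :=
  (hd.isIwasawaExponent (N := N)).heckeEigencharacter_comp_inv_eq w χ fun T =>
    hd.domCongr_neg_satakeTransform_of_units_orthogonal u hu w hw T

end UnramifiedLocalConjDatum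

end Literature.NumberTheory.Automorphic.HermitianLattice

/-! ## §4 `U_N(E_w/F_v)` at every inert unramified place -/

namespace Literature.NumberTheory.Automorphic.UnitaryGroup

open Literature.NumberTheory.Automorphic.HermitianLattice Literature.NumberTheory.Automorphic

variable {F E : Type} [Field F] [NumberField F] [Field E] [NumberField E] [Algebra F E] [Algebra.IsQuadraticExtension F E]
  (c : E ≃ₐ[F] E) (hc1 : c ≠ 1) (v : HeightOneSpectrum (𝓞 F)) (w : PlacesOver E v) (hw : c • w.1 = w.1)
  (hv : Algebra.IsUnramifiedIn (𝓞 E) v.asIdeal) {N : ℕ}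

/-- **`λ_{β⁻¹} = λ_β` FOR `U_N(E_w/F_v)` AT EVERY INERT UNRAMIFIED PLACE**, every `N`, every `β ∈ (ℂˣ)^N`: the unramified
Hecke eigencharacters `unitaryHeckeEigencharacterAdic` do not separate a torus parameter from its inverse.
[cite: CartierCorvallis1979, §IV (4.2)–(4.4), Thm. 4.1] [cite: Minguez2011, §4] -/
theorem unitaryHeckeEigencharacterAdic_inv (β : Fin N → ℂˣ) :
    unitaryHeckeEigencharacterAdic c hc1 v w hw hv β⁻¹ = unitaryHeckeEigencharacterAdic c hc1 v w hw hv β := by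
  haveI := finite_residueField_adicCompletion E w.1
  haveI := isHeckeTriple_unitaryInt_adicCompletion c v w hw ((StdForm.antidiagonal N).over (w.1.adicCompletion E))
  rw [unitaryHeckeEigencharacterAdic_eq c hc1 v w hw hv (unramifiedLocalConjDatum_localConjUniformizer c hc1 v w hw hv),
    unitaryHeckeEigencharacterAdic_eq c hc1 v w hw hv (unramifiedLocalConjDatum_localConjUniformizer c hc1 v w hw hv)]
  exact (unramifiedLocalConjDatum_localConjUniformizer c hc1 v w hw hv).heckeEigencharacter_inv_unitary
    (exists_galAdicCompletionMap_ne c hc1 v w hw) β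

end Literature.NumberTheory.Automorphic.UnitaryGroup
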